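import Mathlib
import HarnessLib
import Summits.NavierStokesRegularity.NavierStokesRegularity.Theses.RigidMotionDoor

/-!
# `RigidMotionDoor.Assembly` (item stmt-NavierStokesRegularity-27905) — pure logic

`Assembly` is `RigidZoom → EuclidAccumulation → TranslationEndLiouville → AxisymEndLiouville → ConstantSliceExtinction → Target`, i.e. the
type of the route's planner-authored deciding theorem `Theses.RigidMotionDoor.closes` (kernel-checked in the route file); this item is that
composition BY NAME.

HONEST FRAMING: bookkeeping; the door's `Target` is proved in `…RigidMotionDoorTarget`, not here; nothing in this file bears on Navier–Stokes
regularity, and no summit statement (Clay A–D) is touched.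
-/

noncomputable section

set_option linter.dupNamespace false

namespace Summit.NavierStokesRegularity.NavierStokesRegularity.Theorems

open Summit.NavierStokesRegularity.NavierStokesRegularity.Theses.RigidMotionDoor

/-- **Item stmt-NavierStokesRegularity-27905** (`RigidMotionDoor.Assembly`): the five items compose to the door's `Target` — by the route's own
kernel-checked deciding theorem `closes`. [folklore] -/
theorem rigidMotionDoor_assembly_proof :
    Summit.NavierStokesRegularity.NavierStokesRegularity.Theses.RigidMotionDoor.Assembly := by
  unfold Summit.NavierStokesRegularity.NavierStokesRegularity.Theses.RigidMotionDoor.Assembly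
  exact fun hZ hA hT hL hE => closes hZ hA hT hL hE

end Summit.NavierStokesRegularity.NavierStokesRegularity.Theorems

end
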